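import Summits.QuantumFields.BalabanUV.Beta.FP.CoarseJetOrderOneGraded
import Summits.QuantumFields.BalabanUV.Beta.FP.RelInvPeriodisedCombRecord
import Summits.QuantumFields.BalabanUV.Beta.FP.RelInvPeriodisedCombMinOp

/-!
# `BalabanUV.Beta.FP.CoarseJetOrderOneGradedComb` — road «FP» (binder row D1), ROUTE T, presentation T-β, option (δ) «LIFT ∕ GRADED» (R-FP-54′), the (J-a) dictionary's item
# **(γ-sym)** at ORDER 1: **THE GRADED COARSE FIRST JET OF THE TORUS CALL AND THE `hId₁` SANDWICH, FOR THE CHART-(III′) TABLES** — leaf-05 g28's `CoarseJetOrderOneGraded` §2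
# re-read at `𝕄′_j = bhKStepSh d Lc (Dsh Lc) j`, `Â′ = perF M (GcombSh Lc j)` (both the live-masked `Θ ∕ Θᴸ` AND the `μμ` block `Ŝ` are read off `Â′` — (E) for chart (III′))

HONEST DEPENDENCY (page 1, mandatory): continuum YM on T⁴ ⇐ BetaPertH ∧ nine spine estimates (0/9 proved); BetaPertH ⇐ (D1) ∧ (D4) ∧
CAP+tail; G-an2-4 gates asym, D1 and NE2/3/4.  HONEST FRAMING (cell contract, verbatim): «discharging `BetaPertH` makes Bałaban's UV
stability UNCONDITIONAL — a real constructive-QFT result; it is NOT the continuum limit and NOT the Clay problem.»  ABSOLUTE RULE (cell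
charter, verbatim): «No internally-minted statement may enter as a cited fact. Every hypothesis is either kernel-proved in this package or a
verbatim quotation of a PUBLISHED theorem with page reference. The manuscript(s) under audit are NOT citable for their own disputed steps — they
are the thing under adjudication; programme-internal (2001/route/tribunal) claims are never citable.»

CONTENT = `CoarseJetOrderOneGraded` §2 with the rooted record theorems replaced by their chart-(III′) twins (`RelInvPeriodisedCombMinOp.torus_minOp(L)_submatrix_inl_comb`,
`RelInvPeriodisedCombRecord.effForm_toBlocks₁₁_comb`), the generic §1 (`orderOne_word_toBlocks₁₁_graded(_symm)`) reused BY NAME; root `ρ_c = ctr (d+1) Lc`, `τ₁ := combRowsT (ctr (d+1) Lc) Lc M`: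
`torus_orderOne_word_toBlocks₁₁_graded_comb`, `torus_hId₁_iff_graded_comb`, `torus_orderOne_word_toBlocks₁₁_graded_symm_comb` — every `d`, `Lc ≥ 1`, EVERY level `j`, every box with `Lc ∣ M_i`.
[folklore] three-line readings; nothing of an1's ∕ an2's ∕ leaf-02's ∕ leaf-03's restated; no `Prop`, no `def`, nothing cited, 0 sorry; discharges NO binder of row D1; NOT the dictionary's
`hId₁` (it makes its left side explicit at the sym tables), NOT (J-a), NOT (T-ID), NOT SDF, NOT D1, NOT BetaPertH, NOT continuum, NOT Clay; 0 estimates.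
Unit `b2b-balaban-beta-d1-formalise-leaf-05` (gen 29), 2026-08-22; no existing file touched.
-/

noncomputable section

open scoped BigOperators Matrix

namespace Summit.QuantumFields.BalabanUV.Beta.FP.CoarseJetOrderOneGradedComb

open Matrix
open Literature.Probability.LatticeModels (Torus.proj)
open Literature.MathematicalPhysics.QuantumFieldTheory.Balaban1983to89
open Literature.MathematicalPhysics.QuantumFieldTheory.Balaban1983to89.Beta
open Literature.MathematicalPhysics.QuantumFieldTheory.Balaban1983to89.Beta.Composition (kkt)
open Literature.MathematicalPhysics.QuantumFieldTheory.Balaban1983to89.Beta.CompositionSingular (effForm flucCov minOp minOpL minOpL_eq_transpose)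
open B6Lemma24Torus (pbox)
open AffineAveraging (Site box toSite)
open AveragingContoursRooted (ctr ctrOff)
open OneStepResolventKernel (Fib)
open Summit.QuantumFields.BalabanUV.Beta.AxialDressingRooted (axEc)
open Summit.QuantumFields.BalabanUV.Beta.SymShiftedSpread (bhKStepSh)
open Summit.QuantumFields.BalabanUV.Beta.DshAn1 (Dsh)
open Summit.QuantumFields.BalabanUV.Beta.CombChartStepJets (GcombSh)
open Summit.QuantumFields.BalabanUV.Beta.FP.KernelPeriodisationFib (Idx perF)
open Summit.QuantumFields.BalabanUV.Beta.FP.TorusCombRows (Res combRowsT)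
open Summit.QuantumFields.BalabanUV.Beta.FP.RelInvPeriodisedCombRecord (effForm_toBlocks₁₁_comb)
open Summit.QuantumFields.BalabanUV.Beta.FP.RelInvPeriodisedCombMinOp (torus_minOp_submatrix_inl_comb torus_minOpL_submatrix_inl_comb torus_flucCov_eq_comb)
open Summit.QuantumFields.BalabanUV.Beta.FP.CoarseJetOrderOneGraded (orderOne_word_toBlocks₁₁_graded orderOne_word_toBlocks₁₁_graded_symm)

/-! ## §2 At the chart-(III′) record: the coarse first jet is the `Â′`-sandwich of the level-`j` first insertion tables -/

section Record

variable {d : ℕ} {Lc : ℕ} [NeZero Lc] (M : Fin (d + 1) → ℕ) [∀ μ, NeZero (M μ)]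

set_option synthInstance.maxSize 1024 in
/-- **[folklore] THE COARSE FIRST JET OF THE TORUS CALL IN CLOSED FORM.**  On any box `M` with `Lc ∣ Mᵢ`, root `ρ_c = ctr (d+1) Lc`, at the
presentation of record (`H₀ Q₁₀ τ₁` by the defining equations of p313662 with coarse multipliers presented by any injective `inr`-valued `fμ`
with `hcoarse`; namings `hI hL hS` of the minimiser, its left companion and the effective form, `hB : [Q₁₁;0] = B`), for ANY first jets
`H₁ : Matrix ν ν ℝ`, `Q₁₁ : Matrix μ ν ℝ`:
`((L·H₁ − S·B)·I + L·Bᵀ·S).toBlocks₁₁ = −(Θᴸ·H₁·Θ) − Ŝ·Q₁₁·Θ − Θᴸ·Q₁₁ᵀ·Ŝ` (GRADED), where `Θ (s,α) a := axEc s s (inl α) (inl α) · Â (s, inl α) (fμ a)`,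
`Θᴸ a (s,α) := axEc s s (inl α) (inl α) · Â (fμ a) (s, inl α)`, `Ŝ := (perF M (GcombSh Lc j))∘(fμ,fμ)`, `Â := perF M (GcombSh Lc j)`. -/
theorem torus_orderOne_word_toBlocks₁₁_graded_comb (hM : ∀ i, Lc ∣ M i) (j : ℕ)
    {μ : Type*} [Fintype μ] [DecidableEq μ] (fμ : μ → Idx M (Fib d)) (hfμ : Function.Injective fμ)
    (hμ : ∀ a : μ, ∃ m : Fin (d + 1), (fμ a).2 = Sum.inr m)
    (hcoarse : ∀ (s : ↥(pbox M)) (m : Fin (d + 1)), ((s, Sum.inr m) : Idx M (Fib d)) ∈ Set.range fμ ↔ Torus.proj Lc (s : Site (d + 1)) = 0)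
    -- the fine sliced system of record, by defining equations
    {H₀ : Matrix (↥(pbox M) × Fin (d + 1)) (↥(pbox M) × Fin (d + 1)) ℝ} {Q₁₀ : Matrix μ (↥(pbox M) × Fin (d + 1)) ℝ}
    {τ₁ : Matrix (Res (ctr (d + 1) Lc) Lc M) (↥(pbox M) × Fin (d + 1)) ℝ}
    (hH₀ : H₀ = (perF M (bhKStepSh d Lc (Dsh Lc) j)).submatrix
        (fun b : ↥(pbox M) × Fin (d + 1) => ((b.1, Sum.inl b.2) : Idx M (Fib d))) (fun b : ↥(pbox M) × Fin (d + 1) => ((b.1, Sum.inl b.2) : Idx M (Fib d))))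
    (hQ₁₀ : Q₁₀ = (perF M (bhKStepSh d Lc (Dsh Lc) j)).submatrix fμ (fun b : ↥(pbox M) × Fin (d + 1) => ((b.1, Sum.inl b.2) : Idx M (Fib d))))
    (hτ₁ : τ₁ = (combRowsT (ctr (d + 1) Lc) Lc M).submatrix id (fun b : ↥(pbox M) × Fin (d + 1) => ((b.1, Sum.inl b.2) : Idx M (Fib d))))
    -- the blocks of its inverse and the sliced border jet, NAMED (p308750's `hI hL hS hB`)
    {I : Matrix (↥(pbox M) × Fin (d + 1)) (μ ⊕ Res (ctr (d + 1) Lc) Lc M) ℝ} {L : Matrix (μ ⊕ Res (ctr (d + 1) Lc) Lc M) (↥(pbox M) × Fin (d + 1)) ℝ}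
    {S : Matrix (μ ⊕ Res (ctr (d + 1) Lc) Lc M) (μ ⊕ Res (ctr (d + 1) Lc) Lc M) ℝ} {B : Matrix (μ ⊕ Res (ctr (d + 1) Lc) Lc M) (↥(pbox M) × Fin (d + 1)) ℝ}
    (hI : minOp H₀ (fromRows Q₁₀ τ₁) = I) (hL : minOpL H₀ (fromRows Q₁₀ τ₁) = L) (hS : effForm H₀ (fromRows Q₁₀ τ₁) = S)
    (H₁ : Matrix (↥(pbox M) × Fin (d + 1)) (↥(pbox M) × Fin (d + 1)) ℝ) (Q₁₁ : Matrix μ (↥(pbox M) × Fin (d + 1)) ℝ)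
    (hB : fromRows Q₁₁ (0 : Matrix (Res (ctr (d + 1) Lc) Lc M) (↥(pbox M) × Fin (d + 1)) ℝ) = B) :
    ((L * H₁ - S * B) * I + L * Bᵀ * S).toBlocks₁₁
      = -((Matrix.of fun (a : μ) (b : ↥(pbox M) × Fin (d + 1)) =>
              axEc (ctr (d + 1) Lc) Lc (b.1 : Site (d + 1)) (b.1 : Site (d + 1)) (Sum.inl b.2) (Sum.inl b.2)
                * perF M (GcombSh (d := d) Lc j) (fμ a) (b.1, Sum.inl b.2))
            * H₁
            * (Matrix.of fun (b : ↥(pbox M) × Fin (d + 1)) (a : μ) =>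
                axEc (ctr (d + 1) Lc) Lc (b.1 : Site (d + 1)) (b.1 : Site (d + 1)) (Sum.inl b.2) (Sum.inl b.2)
                  * perF M (GcombSh (d := d) Lc j) (b.1, Sum.inl b.2) (fμ a)))
        - (perF M (GcombSh (d := d) Lc j)).submatrix fμ fμ * Q₁₁
            * (Matrix.of fun (b : ↥(pbox M) × Fin (d + 1)) (a : μ) =>
                axEc (ctr (d + 1) Lc) Lc (b.1 : Site (d + 1)) (b.1 : Site (d + 1)) (Sum.inl b.2) (Sum.inl b.2)
                  * perF M (GcombSh (d := d) Lc j) (b.1, Sum.inl b.2) (fμ a))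
        - (Matrix.of fun (a : μ) (b : ↥(pbox M) × Fin (d + 1)) =>
              axEc (ctr (d + 1) Lc) Lc (b.1 : Site (d + 1)) (b.1 : Site (d + 1)) (Sum.inl b.2) (Sum.inl b.2)
                * perF M (GcombSh (d := d) Lc j) (fμ a) (b.1, Sum.inl b.2))
            * Q₁₁ᵀ * (perF M (GcombSh (d := d) Lc j)).submatrix fμ fμ := by
  rw [orderOne_word_toBlocks₁₁_graded H₁ Q₁₁ I L S hB, ← hI, ← hL, ← hS, hH₀, hQ₁₀, hτ₁,
    torus_minOp_submatrix_inl_comb M hM j fμ hfμ hμ hcoarse, torus_minOpL_submatrix_inl_comb M hM j fμ hfμ hμ hcoarse,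
    effForm_toBlocks₁₁_comb M hM j fμ hfμ hμ hcoarse]
  simp only [Matrix.neg_mul, ← sub_eq_add_neg]

set_option synthInstance.maxSize 1024 in
/-- **[folklore] THE DICTIONARY's `hId₁` IS THE SANDWICH IDENTITY.**  In the setting of `torus_orderOne_word_toBlocks₁₁_graded`, for any scalar `c` and any
candidate level-`(j+1)` first insertion table `H'₁`:
`((L·H₁ − S·B)·I + L·Bᵀ·S).toBlocks₁₁ = c • H'₁ ↔ −(Θᴸ·H₁·Θ) − Ŝ·Q₁₁·Θ − Θᴸ·Q₁₁ᵀ·Ŝ = c • H'₁` (GRADED). -/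
theorem torus_hId₁_iff_graded_comb (hM : ∀ i, Lc ∣ M i) (j : ℕ)
    {μ : Type*} [Fintype μ] [DecidableEq μ] (fμ : μ → Idx M (Fib d)) (hfμ : Function.Injective fμ)
    (hμ : ∀ a : μ, ∃ m : Fin (d + 1), (fμ a).2 = Sum.inr m)
    (hcoarse : ∀ (s : ↥(pbox M)) (m : Fin (d + 1)), ((s, Sum.inr m) : Idx M (Fib d)) ∈ Set.range fμ ↔ Torus.proj Lc (s : Site (d + 1)) = 0)
    {H₀ : Matrix (↥(pbox M) × Fin (d + 1)) (↥(pbox M) × Fin (d + 1)) ℝ} {Q₁₀ : Matrix μ (↥(pbox M) × Fin (d + 1)) ℝ}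
    {τ₁ : Matrix (Res (ctr (d + 1) Lc) Lc M) (↥(pbox M) × Fin (d + 1)) ℝ}
    (hH₀ : H₀ = (perF M (bhKStepSh d Lc (Dsh Lc) j)).submatrix
        (fun b : ↥(pbox M) × Fin (d + 1) => ((b.1, Sum.inl b.2) : Idx M (Fib d))) (fun b : ↥(pbox M) × Fin (d + 1) => ((b.1, Sum.inl b.2) : Idx M (Fib d))))
    (hQ₁₀ : Q₁₀ = (perF M (bhKStepSh d Lc (Dsh Lc) j)).submatrix fμ (fun b : ↥(pbox M) × Fin (d + 1) => ((b.1, Sum.inl b.2) : Idx M (Fib d))))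
    (hτ₁ : τ₁ = (combRowsT (ctr (d + 1) Lc) Lc M).submatrix id (fun b : ↥(pbox M) × Fin (d + 1) => ((b.1, Sum.inl b.2) : Idx M (Fib d))))
    {I : Matrix (↥(pbox M) × Fin (d + 1)) (μ ⊕ Res (ctr (d + 1) Lc) Lc M) ℝ} {L : Matrix (μ ⊕ Res (ctr (d + 1) Lc) Lc M) (↥(pbox M) × Fin (d + 1)) ℝ}
    {S : Matrix (μ ⊕ Res (ctr (d + 1) Lc) Lc M) (μ ⊕ Res (ctr (d + 1) Lc) Lc M) ℝ} {B : Matrix (μ ⊕ Res (ctr (d + 1) Lc) Lc M) (↥(pbox M) × Fin (d + 1)) ℝ}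
    (hI : minOp H₀ (fromRows Q₁₀ τ₁) = I) (hL : minOpL H₀ (fromRows Q₁₀ τ₁) = L) (hS : effForm H₀ (fromRows Q₁₀ τ₁) = S)
    (H₁ : Matrix (↥(pbox M) × Fin (d + 1)) (↥(pbox M) × Fin (d + 1)) ℝ) (Q₁₁ : Matrix μ (↥(pbox M) × Fin (d + 1)) ℝ)
    (hB : fromRows Q₁₁ (0 : Matrix (Res (ctr (d + 1) Lc) Lc M) (↥(pbox M) × Fin (d + 1)) ℝ) = B)
    (c : ℝ) (H'₁ : Matrix μ μ ℝ) :
    ((L * H₁ - S * B) * I + L * Bᵀ * S).toBlocks₁₁ = c • H'₁ ↔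
      -((Matrix.of fun (a : μ) (b : ↥(pbox M) × Fin (d + 1)) =>
              axEc (ctr (d + 1) Lc) Lc (b.1 : Site (d + 1)) (b.1 : Site (d + 1)) (Sum.inl b.2) (Sum.inl b.2)
                * perF M (GcombSh (d := d) Lc j) (fμ a) (b.1, Sum.inl b.2))
            * H₁
            * (Matrix.of fun (b : ↥(pbox M) × Fin (d + 1)) (a : μ) =>
                axEc (ctr (d + 1) Lc) Lc (b.1 : Site (d + 1)) (b.1 : Site (d + 1)) (Sum.inl b.2) (Sum.inl b.2)
                  * perF M (GcombSh (d := d) Lc j) (b.1, Sum.inl b.2) (fμ a)))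
        - (perF M (GcombSh (d := d) Lc j)).submatrix fμ fμ * Q₁₁
            * (Matrix.of fun (b : ↥(pbox M) × Fin (d + 1)) (a : μ) =>
                axEc (ctr (d + 1) Lc) Lc (b.1 : Site (d + 1)) (b.1 : Site (d + 1)) (Sum.inl b.2) (Sum.inl b.2)
                  * perF M (GcombSh (d := d) Lc j) (b.1, Sum.inl b.2) (fμ a))
        - (Matrix.of fun (a : μ) (b : ↥(pbox M) × Fin (d + 1)) =>
              axEc (ctr (d + 1) Lc) Lc (b.1 : Site (d + 1)) (b.1 : Site (d + 1)) (Sum.inl b.2) (Sum.inl b.2)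
                * perF M (GcombSh (d := d) Lc j) (fμ a) (b.1, Sum.inl b.2))
            * Q₁₁ᵀ * (perF M (GcombSh (d := d) Lc j)).submatrix fμ fμ
        = c • H'₁ := by
  rw [torus_orderOne_word_toBlocks₁₁_graded_comb M hM j fμ hfμ hμ hcoarse hH₀ hQ₁₀ hτ₁ hI hL hS H₁ Q₁₁ hB]

set_option synthInstance.maxSize 1024 in
/-- **[folklore] SYMMETRIC FORM AT THE RECORD**: with the fine form symmetric (`hH₀t : H₀ᵀ = H₀`, displayed — leaf-02's `PeriodisedWardOrderZero.torus_H₀_transpose`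
discharges it), the GRADED coarse first jet is `Θᵀ·H₁·Θ − (Ŝ·Q₁₁·Θ − (Ŝ·Q₁₁·Θ)ᵀ)` — ANTISYMMETRIC for antisymmetric `H₁` — so the dictionary's graded `hId₁` reads
`(wVH (j+1))⁻¹ • H'₁ = Θᵀ·H₁·Θ − (Ŝ·Q₁₁·Θ − (Ŝ·Q₁₁·Θ)ᵀ)`: the level-`(j+1)` first insertion table is the `Θ`-pullback of the level-`j` first form
insertion minus the ANTIsymmetrised `Ŝ·Q₁₁·Θ` (averaging insertion read through the effective form and the minimiser). -/
theorem torus_orderOne_word_toBlocks₁₁_graded_symm_comb (hM : ∀ i, Lc ∣ M i) (j : ℕ)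
    {μ : Type*} [Fintype μ] [DecidableEq μ] (fμ : μ → Idx M (Fib d)) (hfμ : Function.Injective fμ)
    (hμ : ∀ a : μ, ∃ m : Fin (d + 1), (fμ a).2 = Sum.inr m)
    (hcoarse : ∀ (s : ↥(pbox M)) (m : Fin (d + 1)), ((s, Sum.inr m) : Idx M (Fib d)) ∈ Set.range fμ ↔ Torus.proj Lc (s : Site (d + 1)) = 0)
    {H₀ : Matrix (↥(pbox M) × Fin (d + 1)) (↥(pbox M) × Fin (d + 1)) ℝ} {Q₁₀ : Matrix μ (↥(pbox M) × Fin (d + 1)) ℝ}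
    {τ₁ : Matrix (Res (ctr (d + 1) Lc) Lc M) (↥(pbox M) × Fin (d + 1)) ℝ}
    (hH₀ : H₀ = (perF M (bhKStepSh d Lc (Dsh Lc) j)).submatrix
        (fun b : ↥(pbox M) × Fin (d + 1) => ((b.1, Sum.inl b.2) : Idx M (Fib d))) (fun b : ↥(pbox M) × Fin (d + 1) => ((b.1, Sum.inl b.2) : Idx M (Fib d))))
    (hQ₁₀ : Q₁₀ = (perF M (bhKStepSh d Lc (Dsh Lc) j)).submatrix fμ (fun b : ↥(pbox M) × Fin (d + 1) => ((b.1, Sum.inl b.2) : Idx M (Fib d))))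
    (hτ₁ : τ₁ = (combRowsT (ctr (d + 1) Lc) Lc M).submatrix id (fun b : ↥(pbox M) × Fin (d + 1) => ((b.1, Sum.inl b.2) : Idx M (Fib d))))
    (hH₀t : H₀ᵀ = H₀)
    {I : Matrix (↥(pbox M) × Fin (d + 1)) (μ ⊕ Res (ctr (d + 1) Lc) Lc M) ℝ} {L : Matrix (μ ⊕ Res (ctr (d + 1) Lc) Lc M) (↥(pbox M) × Fin (d + 1)) ℝ}
    {S : Matrix (μ ⊕ Res (ctr (d + 1) Lc) Lc M) (μ ⊕ Res (ctr (d + 1) Lc) Lc M) ℝ} {B : Matrix (μ ⊕ Res (ctr (d + 1) Lc) Lc M) (↥(pbox M) × Fin (d + 1)) ℝ}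
    (hI : minOp H₀ (fromRows Q₁₀ τ₁) = I) (hL : minOpL H₀ (fromRows Q₁₀ τ₁) = L) (hS : effForm H₀ (fromRows Q₁₀ τ₁) = S)
    (H₁ : Matrix (↥(pbox M) × Fin (d + 1)) (↥(pbox M) × Fin (d + 1)) ℝ) (Q₁₁ : Matrix μ (↥(pbox M) × Fin (d + 1)) ℝ)
    (hB : fromRows Q₁₁ (0 : Matrix (Res (ctr (d + 1) Lc) Lc M) (↥(pbox M) × Fin (d + 1)) ℝ) = B) :
    ((L * H₁ - S * B) * I + L * Bᵀ * S).toBlocks₁₁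
      = (Matrix.of fun (b : ↥(pbox M) × Fin (d + 1)) (a : μ) =>
            axEc (ctr (d + 1) Lc) Lc (b.1 : Site (d + 1)) (b.1 : Site (d + 1)) (Sum.inl b.2) (Sum.inl b.2)
              * perF M (GcombSh (d := d) Lc j) (b.1, Sum.inl b.2) (fμ a))ᵀ
          * H₁
          * (Matrix.of fun (b : ↥(pbox M) × Fin (d + 1)) (a : μ) =>
              axEc (ctr (d + 1) Lc) Lc (b.1 : Site (d + 1)) (b.1 : Site (d + 1)) (Sum.inl b.2) (Sum.inl b.2)
                * perF M (GcombSh (d := d) Lc j) (b.1, Sum.inl b.2) (fμ a))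
        - ((perF M (GcombSh (d := d) Lc j)).submatrix fμ fμ * Q₁₁
              * (Matrix.of fun (b : ↥(pbox M) × Fin (d + 1)) (a : μ) =>
                  axEc (ctr (d + 1) Lc) Lc (b.1 : Site (d + 1)) (b.1 : Site (d + 1)) (Sum.inl b.2) (Sum.inl b.2)
                    * perF M (GcombSh (d := d) Lc j) (b.1, Sum.inl b.2) (fμ a))
            - ((perF M (GcombSh (d := d) Lc j)).submatrix fμ fμ * Q₁₁
                * (Matrix.of fun (b : ↥(pbox M) × Fin (d + 1)) (a : μ) =>
                    axEc (ctr (d + 1) Lc) Lc (b.1 : Site (d + 1)) (b.1 : Site (d + 1)) (Sum.inl b.2) (Sum.inl b.2)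
                      * perF M (GcombSh (d := d) Lc j) (b.1, Sum.inl b.2) (fμ a)))ᵀ) := by
  rw [orderOne_word_toBlocks₁₁_graded_symm H₀ Q₁₀ τ₁ hH₀t H₁ Q₁₁ hI hL hS hB, ← hI, ← hS, hH₀, hQ₁₀, hτ₁,
    torus_minOp_submatrix_inl_comb M hM j fμ hfμ hμ hcoarse, effForm_toBlocks₁₁_comb M hM j fμ hfμ hμ hcoarse]

end Record

end Summit.QuantumFields.BalabanUV.Beta.FP.CoarseJetOrderOneGradedComb

end
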